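import Summits.AtomisticToContinuum.Crystallization.Theses.PricedLinkCensus

/-!
# Route PricedLinkCensus — helpers for the hinge `StackingHinge` (stmt-AtomisticToContinuum-14238)

`StackingHinge` is `SoftLayerPropagation → ChargeFreeWindows → GSCP`, where `GSCP` is the shared
hinge `GroundStatesChargePeriodic` (stmt-AtomisticToContinuum-2911) written out verbatim.  This
file records

* `stackingHinge_of_groundStatesChargePeriodic` — the hinge is a formal corollary of 2911 (the two
  antecedents are simply dropped);
* `barlowWindows_ae` — what the two antecedents DO deliver along a sequence of Lennard-Jones
  ground states: for every `R > 0`, the fraction of sites `i` having some site `j` within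
  `R · nn_i` whose `3 nn_j`-window is NOT `(nn_j / 6)`-matched both ways to a rigid image of an
  ideal Barlow stacking at scale `nn_j` tends to `0` (charge-free windows of radius `(9R + 8) nn_i`
  feed the hypothesis of soft layer propagation at every site of the `R nn_i`-window, because
  `nn_j ≤ dist (x j) (x i) ≤ R nn_i` for `j ≠ i`).  This is a statement about link topology at the
  fixed relative precision `1/6`; it carries no information on strain, stacking word or common
  scale, which the consequent of the hinge asks for at every `(R, ε)`.
-/

namespace Summit.AtomisticToContinuum.Crystallization.Theorems

open Summit.AtomisticToContinuum.Crystallization.Theses.PricedLinkCensus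
open Literature.MathematicalPhysics.StatisticalMechanics Literature.Geometry.DiscreteGeometry
open Filter Topology

/-- **The hinge is a corollary of the shared item 2911.**  `StackingHinge` is
`SoftLayerPropagation → ChargeFreeWindows → GroundStatesChargePeriodic` with the consequent written
out verbatim, so a proof of `GroundStatesChargePeriodic` closes it by discarding the two
antecedents. [folklore] -/
theorem stackingHinge_of_groundStatesChargePeriodic (h : GroundStatesChargePeriodic) :
    StackingHinge :=
  fun _ _ => h

/-- One step of the window bookkeeping: if every site within `(9 R + 8) · nn_i` of `y i` is
charge-free, then every site `j` within `R · nn_i` of `y i` has ALL sites within `8 · nn_j` of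
`y j` charge-free (for `j ≠ i`, `nn_j ≤ dist (y j) (y i) ≤ R · nn_i`; for `j = i` directly).
[folklore] -/
theorem chargeFree_window_of_large_window {N : ℕ} {η R : ℝ} (hR : 0 ≤ R)
    (y : Fin N → EuclideanSpace ℝ (Fin 3)) (i : Fin N)
    (h : ∀ k : Fin N, dist (y i) (y k) ≤ (9 * R + 8) * nearestDist y i → IsChargeFree η y k)
    {j : Fin N} (hj : dist (y i) (y j) ≤ R * nearestDist y i) :
    ∀ k : Fin N, dist (y j) (y k) ≤ 8 * nearestDist y j → IsChargeFree η y k := by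
  intro k hk
  apply h
  have hnn_i : 0 ≤ nearestDist y i := nearestDist_nonneg y i
  by_cases hji : j = i
  · subst hji
    calc dist (y j) (y k) ≤ 8 * nearestDist y j := hk
      _ ≤ (9 * R + 8) * nearestDist y j := by nlinarith
  · have hnn_j : nearestDist y j ≤ R * nearestDist y i :=
      (nearestDist_le_dist y (Ne.symm hji)).trans (by rwa [dist_comm] at hj)
    calc dist (y i) (y k) ≤ dist (y i) (y j) + dist (y j) (y k) := dist_triangle _ _ _
      _ ≤ R * nearestDist y i + 8 * nearestDist y j := add_le_add hj hk
      _ ≤ R * nearestDist y i + 8 * (R * nearestDist y i) := by nlinarith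
      _ ≤ (9 * R + 8) * nearestDist y i := by nlinarith

/-- **Locally-Barlow windows almost everywhere** — the honest content of the two antecedents of
`StackingHinge`.  Assume `SoftLayerPropagation` and `ChargeFreeWindows`.  Then for every `R > 0`
and every sequence of Lennard-Jones ground states `x N`, the fraction of sites `i` of `x N` for
which some site `j` with `dist (x N i) (x N j) ≤ R · nn_i` fails the conclusion of soft layer
propagation (a Hägg sequence `s` and a rigid motion `g` such that the sites within `3 nn_j` of
`x N j` and the points of `g '' barlowStacking nn_j (nn_j √(2/3)) s` within `3 nn_j` of `x N j`
are matched both ways at tolerance `nn_j / 6`) tends to `0`.  Proof: by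
`chargeFree_window_of_large_window` the exceptional set is contained in the exceptional set of
`ChargeFreeWindows` at radius `9 R + 8`, and soft layer propagation is applied at `η = 1/100`;
squeeze. [folklore] -/
theorem barlowWindows_ae (hSLP : SoftLayerPropagation) (hCFW : ChargeFreeWindows) (R : ℝ)
    (hR : 0 < R) (x : (N : ℕ) → (Fin N → EuclideanSpace ℝ (Fin 3)))
    (hx : ∀ N, IsGroundState lennardJones (x N)) :
    Tendsto (fun N : ℕ => (Nat.card {i : Fin N // ¬ ∀ j : Fin N,
      dist (x N i) (x N j) ≤ R * nearestDist (x N) i →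
        ∃ (s : ℤ → ℤ) (g : EuclideanSpace ℝ (Fin 3) ≃ᵃⁱ[ℝ] EuclideanSpace ℝ (Fin 3)),
          IsHaggSeq s ∧
          (∀ k : Fin N, dist (x N j) (x N k) ≤ 3 * nearestDist (x N) j →
            ∃ z ∈ barlowStacking (nearestDist (x N) j) (nearestDist (x N) j * Real.sqrt (2 / 3)) s,
              dist (x N k) (g z) ≤ nearestDist (x N) j / 6) ∧
          ∀ z ∈ barlowStacking (nearestDist (x N) j) (nearestDist (x N) j * Real.sqrt (2 / 3)) s,
            dist (x N j) (g z) ≤ 3 * nearestDist (x N) j →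
              ∃ k : Fin N, dist (x N k) (g z) ≤ nearestDist (x N) j / 6} : ℝ) / N)
      atTop (𝓝 0) := by
  have hR' : 0 < 9 * R + 8 := by linarith
  have hlim := hCFW (9 * R + 8) hR' x hx
  refine squeeze_zero (fun N => by positivity) (fun N => ?_) hlim
  refine div_le_div_of_nonneg_right ?_ (Nat.cast_nonneg N)
  norm_cast
  refine Nat.card_le_card_of_injective (Subtype.map id fun i hi => ?_)
    (Subtype.map_injective _ Function.injective_id)
  intro hgood
  apply hi
  intro j hj
  exact hSLP (1 / 100) (by norm_num) le_rfl N (x N) j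
    (chargeFree_window_of_large_window hR.le (x N) i hgood hj)

end Summit.AtomisticToContinuum.Crystallization.Theorems
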